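import Mathlib
import Literature.MathematicalPhysics.StatisticalMechanics.BarlowStacking
import Literature.MathematicalPhysics.StatisticalMechanics.HaggStacking
import Summits.AtomisticToContinuum.Crystallization.Theorems.ChartedPlanarOrderPatternFirstShellA

/-!
# First shell of a flexible-gap Barlow pattern, part B: classification of the root's bond shell

For `b ∈ [9/10, 1]`, a Hägg sequence `s`, free heights `z` with gaps
`z (m+1) - z m ∈ [39b/50, 17b/20]` and `z 0 = 0`, the pattern point
`p = i u_b + j v_b + (haggLabel s m) w_b + z m e₃` satisfies `0 < ‖p‖ ≤ 28/25` iff it is one of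
the six in-plane neighbours (`m = 0`, `i² + ij + j² = 1`, distance `b ≤ 1`) or one of the three
hole positions of an adjacent layer (`m = ±1`, `i² + ij + j² + L_m (i+j) = 0`, distance
`√(b²/3 + g²) ≤ 1.0275`); everything else is at distance `≥ 1.254 > 28/25` (`shell_iff`). This is
the ROOT-DEGREE-12 input of the bond random walk transport
(`ChartedPlanarOrderBondWalkTransport.lintegral_confWalk_iterate`) for exactly patterned laws
(V-line `stub_walkTransport`, K, C-prep Tc); the count itself is part C.
-/

namespace Summit.AtomisticToContinuum.Crystallization.Theorems.ChartedPlanarOrderPatternFirstShellB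

open Literature.MathematicalPhysics.StatisticalMechanics
open Summit.AtomisticToContinuum.Crystallization.Theorems.ChartedPlanarOrderPatternFirstShellA

/-- Square-root bookkeeping: `0 < t ≤ 28/25` iff `0 < t² ≤ (28/25)²` for `t ≥ 0`. -/
theorem shell_sq_iff {t : ℝ} (ht : 0 ≤ t) :
    (0 < t ∧ t ≤ 28 / 25) ↔ (0 < t ^ 2 ∧ t ^ 2 ≤ (28 / 25) ^ 2) := by
  constructor
  · rintro ⟨h1, h2⟩
    exact ⟨by positivity, pow_le_pow_left₀ ht h2 2⟩
  · rintro ⟨h1, h2⟩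
    refine ⟨?_, (pow_le_pow_iff_left₀ ht (by norm_num) two_ne_zero).1 h2⟩
    rcases ht.lt_or_eq with h | h
    · exact h
    · rw [← h] at h1; norm_num at h1

/-- IN-PLANE CORE (`m = 0`): with `t² = b² (i² + ij + j²)`, `0 < t ≤ 28/25` iff
`i² + ij + j² = 1` (`b² · 2 ≥ 1.62 > 1.2544`). -/
theorem inplane_core (b : ℝ) (hb : 9 / 10 ≤ b ∧ b ≤ 1) (i j : ℤ) (t : ℝ) (ht : 0 ≤ t)
    (hnorm : t ^ 2 = b ^ 2 * ((i : ℝ) ^ 2 + i * j + (j : ℝ) ^ 2)) :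
    (0 < t ∧ t ≤ 28 / 25) ↔ i ^ 2 + i * j + j ^ 2 = 1 := by
  rw [shell_sq_iff ht, hnorm]
  have hN0 := (forms_nonneg i j).1
  have hNr : (0 : ℝ) ≤ (i : ℝ) ^ 2 + i * j + (j : ℝ) ^ 2 := by exact_mod_cast hN0
  constructor
  · rintro ⟨hpos, hle⟩
    have hN2 : ((i : ℝ) ^ 2 + i * j + (j : ℝ) ^ 2) < 2 := by
      nlinarith [hb.1, mul_nonneg (mul_nonneg (by norm_num : (0:ℝ) ≤ 81 / 100) hNr) hNr]
    have hN2' : i ^ 2 + i * j + j ^ 2 < 2 := by exact_mod_cast hN2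
    have hNne : i ^ 2 + i * j + j ^ 2 ≠ 0 := by
      intro h0
      have h0r : (i : ℝ) ^ 2 + i * j + (j : ℝ) ^ 2 = 0 := by exact_mod_cast h0
      rw [h0r, mul_zero] at hpos
      exact lt_irrefl _ hpos
    omega
  · intro hN
    have hNr1 : (i : ℝ) ^ 2 + i * j + (j : ℝ) ^ 2 = 1 := by exact_mod_cast hN
    rw [hNr1, mul_one]
    have hbpos : 0 < b := by linarith [hb.1]
    constructor
    · positivity
    · nlinarith [hb.1, hb.2]

/-- ADJACENT-LAYER CORE (`m = ±1`): with `t² = b² (i² + ij + j² + L (i+j) + L²/3) + g²`,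
`L = ±1`, `g² ∈ [(39b/50)², (17b/20)²]`, `0 < t ≤ 28/25` iff `i² + ij + j² + L (i+j) = 0`
(`b²/3 + g² ≤ 1.0558`; the next ring `4b²/3 + g² ≥ 1.572 > 1.2544`). -/
theorem adjacent_core (b : ℝ) (hb : 9 / 10 ≤ b ∧ b ≤ 1) (L : ℤ) (hL : L = 1 ∨ L = -1) (g : ℝ)
    (hg : (39 / 50 * b) ^ 2 ≤ g ^ 2 ∧ g ^ 2 ≤ (17 / 20 * b) ^ 2) (i j : ℤ) (t : ℝ) (ht : 0 ≤ t)
    (hnorm : t ^ 2 = b ^ 2 * ((i : ℝ) ^ 2 + i * j + (j : ℝ) ^ 2 + L * (i + j) + (L : ℝ) ^ 2 / 3)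
      + g ^ 2) :
    (0 < t ∧ t ≤ 28 / 25) ↔ i ^ 2 + i * j + j ^ 2 + L * (i + j) = 0 := by
  rw [shell_sq_iff ht, hnorm]
  have hLsq : (L : ℝ) ^ 2 = 1 := by rcases hL with rfl | rfl <;> norm_num
  rw [hLsq]
  have hNnonneg : 0 ≤ i ^ 2 + i * j + j ^ 2 + L * (i + j) := by
    rcases hL with rfl | rfl
    · have := (forms_nonneg i j).2.1; linarith
    · have := (forms_nonneg i j).2.2; linarith
  have hNr : (0 : ℝ) ≤ (i : ℝ) ^ 2 + i * j + (j : ℝ) ^ 2 + L * (i + j) := by exact_mod_cast hNnonneg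
  constructor
  · rintro ⟨hpos, hle⟩
    have hN1 : (i : ℝ) ^ 2 + i * j + (j : ℝ) ^ 2 + L * (i + j) < 1 := by
      nlinarith [hb.1, hg.1, mul_nonneg (mul_nonneg (by norm_num : (0:ℝ) ≤ 81 / 100) hNr) hNr]
    have hN1' : i ^ 2 + i * j + j ^ 2 + L * (i + j) < 1 := by exact_mod_cast hN1
    omega
  · intro hN
    have hNr0 : (i : ℝ) ^ 2 + i * j + (j : ℝ) ^ 2 + L * (i + j) = 0 := by exact_mod_cast hN
    rw [hNr0, zero_add]
    have hbpos : 0 < b := by linarith [hb.1]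
    constructor
    · positivity
    · nlinarith [hb.1, hb.2, hg.2]

/-- CLASSIFICATION of the root's first shell in pattern coordinates: the point `(m, i, j)` is a
bond-neighbour of the root (`0 < ‖p‖ ≤ 28/25`) iff it is one of the six in-plane neighbours
(`m = 0`, `i² + ij + j² = 1`) or one of the three hole positions of an adjacent layer
(`m = ±1`, `i² + ij + j² + L_m (i + j) = 0`, `L_m = haggLabel s m = ±1`). -/
theorem shell_iff (b : ℝ) (hb : 9 / 10 ≤ b ∧ b ≤ 1) (s : ℤ → ℤ) (hs : IsHaggSeq s) (z : ℤ → ℝ)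
    (hz : ∀ m : ℤ, 39 / 50 * b ≤ z (m + 1) - z m ∧ z (m + 1) - z m ≤ 17 / 20 * b) (hz0 : z 0 = 0)
    (m i j : ℤ) :
    (0 < ‖(i : ℝ) • triangularVec₁ b + (j : ℝ) • triangularVec₂ b + (haggLabel s m : ℝ) • barlowOffset b
        + z m • layerNormal 1‖ ∧
      ‖(i : ℝ) • triangularVec₁ b + (j : ℝ) • triangularVec₂ b + (haggLabel s m : ℝ) • barlowOffset b
        + z m • layerNormal 1‖ ≤ 28 / 25) ↔
    ((m = 0 ∧ i ^ 2 + i * j + j ^ 2 = 1) ∨ (m = 1 ∧ i ^ 2 + i * j + j ^ 2 + haggLabel s 1 * (i + j) = 0)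
      ∨ (m = -1 ∧ i ^ 2 + i * j + j ^ 2 + haggLabel s (-1) * (i + j) = 0)) := by
  have hb0 : 0 ≤ b := by linarith [hb.1]
  obtain ⟨hz1, hzm1, hfar⟩ := heights b hb0 z hz hz0
  have hL1 := haggLabel_one_cases s hs
  have hLm1 := haggLabel_neg_one_cases s hs
  have hnorm := norm_patPos_sq b s z m i j
  set p := (i : ℝ) • triangularVec₁ b + (j : ℝ) • triangularVec₂ b
    + (haggLabel s m : ℝ) • barlowOffset b + z m • layerNormal 1 with hp
  have hg1 : (39 / 50 * b) ^ 2 ≤ (z 1) ^ 2 ∧ (z 1) ^ 2 ≤ (17 / 20 * b) ^ 2 :=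
    ⟨pow_le_pow_left₀ (by positivity) hz1.1 2, pow_le_pow_left₀ (by linarith [hz1.1]) hz1.2 2⟩
  have hgm1 : (39 / 50 * b) ^ 2 ≤ (z (-1)) ^ 2 ∧ (z (-1)) ^ 2 ≤ (17 / 20 * b) ^ 2 := by
    constructor <;> nlinarith [hzm1.1, hzm1.2, hb.1]
  by_cases hm0 : m = 0
  · subst hm0
    simp only [haggLabel_zero, Int.cast_zero, zero_mul, add_zero, hz0, ne_eq, zero_pow,
      OfNat.ofNat_ne_zero, not_false_eq_true, zero_div] at hnorm
    rw [inplane_core b hb i j ‖p‖ (norm_nonneg p) hnorm]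
    simp
  by_cases hm1 : m = 1
  · subst hm1
    rw [adjacent_core b hb (haggLabel s 1) hL1 (z 1) hg1 i j ‖p‖ (norm_nonneg p) hnorm]
    simp
  by_cases hm2 : m = -1
  · subst hm2
    rw [adjacent_core b hb (haggLabel s (-1)) hLm1 (z (-1)) hgm1 i j ‖p‖ (norm_nonneg p) hnorm]
    simp
  -- far layers: `|z m| ≥ 1.404 > 28/25`
  simp only [hm0, hm1, hm2, false_and, or_self, iff_false, not_and, not_le]
  intro _
  have h2 := hfar m hm0 hm1 hm2
  have h3 : |z m| ≤ ‖p‖ := by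
    have habs : |p 2| ≤ ‖p‖ := by
      have h := EuclideanSpace.norm_sq_eq p
      rw [Fin.sum_univ_three, Real.norm_eq_abs, Real.norm_eq_abs, Real.norm_eq_abs] at h
      have h1 : |p 2| ^ 2 ≤ ‖p‖ ^ 2 := by
        rw [h]; nlinarith [sq_nonneg (|p 0|), sq_nonneg (|p 1|)]
      exact (pow_le_pow_iff_left₀ (abs_nonneg _) (norm_nonneg _) two_ne_zero).1 h1
    rwa [hp, patPos_apply_two] at habs
  linarith [hb.1]


/-! ### The count: exactly 12 bond-neighbours of the root -/

/-- Injectivity of the pattern parametrisation `(m, i, j) ↦ A p(m, i, j)` (heights are strictly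
increasing; in-plane coordinates determine `j` then `i`). -/
theorem patPos_injective (b : ℝ) (hb : 9 / 10 ≤ b ∧ b ≤ 1)
    (A : EuclideanSpace ℝ (Fin 3) →ₗᵢ[ℝ] EuclideanSpace ℝ (Fin 3)) (s : ℤ → ℤ) (z : ℤ → ℝ)
    (hz : ∀ m : ℤ, 39 / 50 * b ≤ z (m + 1) - z m ∧ z (m + 1) - z m ≤ 17 / 20 * b) :
    Function.Injective fun t : ℤ × ℤ × ℤ =>
      A ((t.2.1 : ℝ) • triangularVec₁ b + (t.2.2 : ℝ) • triangularVec₂ b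
        + (haggLabel s t.1 : ℝ) • barlowOffset b + z t.1 • layerNormal 1) := by
  have hzmono : StrictMono z :=
    strictMono_int_of_lt_succ fun n => by have := (hz n).1; linarith [hb.1]
  have hb0 : b ≠ 0 := by intro h; rw [h] at hb; linarith [hb.1]
  have h3 : (√3 : ℝ) ≠ 0 := by positivity
  rintro ⟨m, i, j⟩ ⟨m', i', j'⟩ h
  have h' := A.injective h
  simp only at h'
  have e2 := congrArg (fun v : EuclideanSpace ℝ (Fin 3) => v 2) h'
  have e1 := congrArg (fun v : EuclideanSpace ℝ (Fin 3) => v 1) h'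
  have e0 := congrArg (fun v : EuclideanSpace ℝ (Fin 3) => v 0) h'
  simp only [patPos_apply_two, patPos_apply_one, patPos_apply_zero] at e2 e1 e0
  have hm : m = m' := hzmono.injective e2
  subst hm
  have hj : (j : ℝ) = j' := by
    have := mul_left_cancel₀ (by positivity : b * √3 / 2 ≠ 0) e1
    linarith
  have hj' : j = j' := by exact_mod_cast hj
  subst hj'
  have hi : (i : ℝ) = i' := by
    have := mul_left_cancel₀ hb0 e0
    linarith
  have hi' : i = i' := by exact_mod_cast hi
  subst hi'
  rfl

/-- **Exactly 12 bond-neighbours of the root** in a flexible-gap Barlow pattern: for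
`b ∈ [9/10, 1]`, a linear isometry `A`, a Hägg sequence `s` and admissible heights `z`
(`z 0 = 0`), the counting measure of the pattern gives mass `12` to the bond shell
`{y | 0 < dist 0 y ≤ 28/25}` of the root — the ROOT-DEGREE hypothesis (`μ B = 12`) of
`ChartedPlanarOrderBondWalkTransport.lintegral_confWalk_iterate` for exactly patterned laws. -/
theorem firstShell_count_eq_twelve (b : ℝ) (hb : 9 / 10 ≤ b ∧ b ≤ 1)
    (A : EuclideanSpace ℝ (Fin 3) →ₗᵢ[ℝ] EuclideanSpace ℝ (Fin 3)) (s : ℤ → ℤ) (hs : IsHaggSeq s)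
    (z : ℤ → ℝ) (hz : ∀ m : ℤ, 39 / 50 * b ≤ z (m + 1) - z m ∧ z (m + 1) - z m ≤ 17 / 20 * b)
    (hz0 : z 0 = 0) :
    ((MeasureTheory.Measure.count : MeasureTheory.Measure (EuclideanSpace ℝ (Fin 3))).restrict
      {p : EuclideanSpace ℝ (Fin 3) | ∃ m i j : ℤ, p = A ((i : ℝ) • triangularVec₁ b
        + (j : ℝ) • triangularVec₂ b + (haggLabel s m : ℝ) • barlowOffset b + z m • layerNormal 1)})
      {y : EuclideanSpace ℝ (Fin 3) | 0 < dist (0 : EuclideanSpace ℝ (Fin 3)) y ∧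
        dist (0 : EuclideanSpace ℝ (Fin 3)) y ≤ 28 / 25} = 12 := by
  classical
  -- the three index sets
  have hL1 := haggLabel_one_cases s hs
  have hLm1 := haggLabel_neg_one_cases s hs
  have hSL : ∀ L : ℤ, (L = 1 ∨ L = -1) → ∃ S : Finset (ℤ × ℤ), S.card = 3 ∧
      ∀ i j : ℤ, (i, j) ∈ S ↔ i ^ 2 + i * j + j ^ 2 + L * (i + j) = 0 := by
    rintro L (rfl | rfl)
    · refine ⟨{(0, 0), (-1, 0), (0, -1)}, by decide, fun i j => ?_⟩
      rw [one_mul]; exact (form_plus_eq_zero_iff i j).symm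
    · refine ⟨{(0, 0), (1, 0), (0, 1)}, by decide, fun i j => ?_⟩
      rw [neg_one_mul, ← sub_eq_add_neg]; exact (form_minus_eq_zero_iff i j).symm
  obtain ⟨S1, hS1c, hS1m⟩ := hSL _ hL1
  obtain ⟨Sm, hSmc, hSmm⟩ := hSL _ hLm1
  set S0 : Finset (ℤ × ℤ) := {(1, 0), (-1, 0), (0, 1), (0, -1), (1, -1), (-1, 1)} with hS0
  have hS0c : S0.card = 6 := by decide
  have hS0m : ∀ i j : ℤ, (i, j) ∈ S0 ↔ i ^ 2 + i * j + j ^ 2 = 1 :=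
    fun i j => (form_eq_one_iff i j).symm
  have himg : ∀ (c m : ℤ) (S : Finset (ℤ × ℤ)) (x : ℤ × ℤ),
      (m, x) ∈ S.image (Prod.mk c) ↔ m = c ∧ x ∈ S := by
    intro c m S x
    simp only [Finset.mem_image, Prod.mk.injEq]
    constructor
    · rintro ⟨y, hy, rfl, rfl⟩; exact ⟨rfl, hy⟩
    · rintro ⟨rfl, hx⟩; exact ⟨x, hx, rfl, rfl⟩
  set T : Finset (ℤ × ℤ × ℤ) :=
    S0.image (Prod.mk 0) ∪ S1.image (Prod.mk 1) ∪ Sm.image (Prod.mk (-1)) with hT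
  have hTm : ∀ m i j : ℤ, (m, (i, j)) ∈ T ↔
      ((m = 0 ∧ i ^ 2 + i * j + j ^ 2 = 1) ∨
        (m = 1 ∧ i ^ 2 + i * j + j ^ 2 + haggLabel s 1 * (i + j) = 0) ∨
        (m = -1 ∧ i ^ 2 + i * j + j ^ 2 + haggLabel s (-1) * (i + j) = 0)) := by
    intro m i j
    simp only [hT, Finset.mem_union, himg, hS0m, hS1m, hSmm, or_assoc]
  have hTc : T.card = 12 := by
    have hd1 : Disjoint (S0.image (Prod.mk (0 : ℤ))) (S1.image (Prod.mk (1 : ℤ))) := by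
      refine Finset.disjoint_left.2 ?_
      rintro ⟨m, x⟩ h h'
      rw [himg] at h h'
      omega
    have hd2 : Disjoint (S0.image (Prod.mk (0 : ℤ)) ∪ S1.image (Prod.mk (1 : ℤ)))
        (Sm.image (Prod.mk (-1 : ℤ))) := by
      refine Finset.disjoint_left.2 ?_
      rintro ⟨m, x⟩ h h'
      rw [Finset.mem_union, himg, himg] at h
      rw [himg] at h'
      omega
    rw [hT, Finset.card_union_of_disjoint hd2, Finset.card_union_of_disjoint hd1,
      Finset.card_image_of_injective _ (Prod.mk_right_injective _),
      Finset.card_image_of_injective _ (Prod.mk_right_injective _),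
      Finset.card_image_of_injective _ (Prod.mk_right_injective _), hS0c, hS1c, hSmc]
  -- the bond shell as an image of `T`
  set φ : ℤ × ℤ × ℤ → EuclideanSpace ℝ (Fin 3) := fun t =>
    A ((t.2.1 : ℝ) • triangularVec₁ b + (t.2.2 : ℝ) • triangularVec₂ b
      + (haggLabel s t.1 : ℝ) • barlowOffset b + z t.1 • layerNormal 1) with hφ
  have hφinj : Function.Injective φ := patPos_injective b hb A s z hz
  have hdist : ∀ m i j : ℤ, dist (0 : EuclideanSpace ℝ (Fin 3)) (φ (m, i, j))
      = ‖(i : ℝ) • triangularVec₁ b + (j : ℝ) • triangularVec₂ b + (haggLabel s m : ℝ) • barlowOffset b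
          + z m • layerNormal 1‖ := by
    intro m i j
    rw [dist_comm, dist_zero_right, hφ]
    exact A.norm_map _
  have hBm : MeasurableSet {y : EuclideanSpace ℝ (Fin 3) | 0 < dist (0 : EuclideanSpace ℝ (Fin 3)) y ∧
      dist (0 : EuclideanSpace ℝ (Fin 3)) y ≤ 28 / 25} :=
    (measurableSet_lt measurable_const (measurable_const.dist measurable_id)).inter
      (measurableSet_le (measurable_const.dist measurable_id) measurable_const)
  rw [MeasureTheory.Measure.restrict_apply hBm]
  have hset : {y : EuclideanSpace ℝ (Fin 3) | 0 < dist (0 : EuclideanSpace ℝ (Fin 3)) y ∧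
      dist (0 : EuclideanSpace ℝ (Fin 3)) y ≤ 28 / 25} ∩
      {p : EuclideanSpace ℝ (Fin 3) | ∃ m i j : ℤ, p = A ((i : ℝ) • triangularVec₁ b
        + (j : ℝ) • triangularVec₂ b + (haggLabel s m : ℝ) • barlowOffset b + z m • layerNormal 1)}
      = ↑(T.image φ) := by
    ext y
    simp only [Set.mem_inter_iff, Set.mem_setOf_eq, Finset.coe_image, Set.mem_image, Finset.mem_coe]
    constructor
    · rintro ⟨hy, m, i, j, rfl⟩
      have key := (shell_iff b hb s hs z hz hz0 m i j).1 (by rw [← hdist m i j]; exact hy)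
      exact ⟨(m, i, j), (hTm m i j).2 key, rfl⟩
    · rintro ⟨⟨m, i, j⟩, hmem, rfl⟩
      have key := (shell_iff b hb s hs z hz hz0 m i j).2 ((hTm m i j).1 hmem)
      exact ⟨by rw [hdist m i j]; exact key, m, i, j, rfl⟩
  rw [hset, MeasureTheory.Measure.count_apply_finset, Finset.card_image_of_injective _ hφinj, hTc]
  norm_num

end Summit.AtomisticToContinuum.Crystallization.Theorems.ChartedPlanarOrderPatternFirstShellB
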